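import Literature.Probability.Percolation.TrapArmPieces
import HarnessLib

/-!
# The setting of the same-colour pair step: two arms, the terms, their stopped fences

Topic `Literature/Probability/Percolation`; family `crit-perc` / near-critical percolation on `𝕋`.
A brick of the near-critical arm-separation theorem for four arms in the ADJACENT colour
arrangement (P. Nolin, EJP 13 (2008), Thm. 11, `j = 4`, `σ = BBWW` [arXiv 0711.4948: Thm. 10];
the last missing input `hsepAdj` of `Werner2009_lemma63_of_altSeparation_of_adjSeparation`).

Nolin 2008, §4.4, proof of Lemma 15, last paragraph: two arms of the same colour arriving on
side `0` of `∂Λ_{2M}` are rerouted along the lowest-crossing exploration of the trapezoid to two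
fenced tips. In the tree this is organised through Menger's theorem; this file fixes the SETTING
and the bookkeeping shared by the no-cut argument (`TrapPairCut.lean`) and the conclusion
(`TrapPairMenger.lean`):

* `PairData M n k₀ K T ω` — two disjoint clean open self-avoiding arms `A i : a i ⇝ y i`
  (`i : Fin 2`) of `{n ≤ |v| ≤ 2M}` ending on `trapO M`, on the raw good event of the
  exploration (`lowestSeq ω T = none`, no `TrapSeqFailRaw M u k₀ K` for `u < T`), with the
  numerical side conditions;
* per term `lowestSeq ω u = (c, z)`: the scale `kOf` (raw-good, `TrapRawOK`), the fence
  `fence : TermFence M c z kOf ω (S c)` stopped at `S c = c ∪ (arms)`;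
* the admissible set `Aset = (arms) ∪ ⋃_u (c_u ∪ F_u)` and the targets `Tset = {m_u}`;
* bookkeeping: arms (`norm_le`, `a0_le`, `armSet_subset`), terms (`term_isCrossing`,
  `term_above_of_lt`, `term_below_of_lt`, `term_offLower_of_lt`, `row_gap_of_lt`), fences
  (`fence_disjoint_arm`, `fence_disjoint_term`, `fence_disjoint_fence`, `term_eq_of_mem_struct`).

Everything here is proved; no named facts are introduced.

## References

* P. Nolin, Near-critical percolation in two dimensions, *Electron. J. Probab.* 13 (2008), §4.4,
  proof of Lemma 15 (arXiv 0711.4948: Lemma 14), last paragraph [Nolin2008].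
* H. Kesten, Scaling relations for 2D-percolation, *Comm. Math. Phys.* 109 (1987), Lemma 2
  [Kesten1987].

Tree: `TrapRawOK`, `TrapSeqFailRaw`, `exists_trapRawOK_of_not_failRaw`
(`ArmSeparationRawGood.lean`), `TermFence` and its planar position (`TrapTermFence.lean`),
`JDomain.lowestSeq*` (`TriLowestCrossing*.lean`), `trapScale`, `triAnnSet`.
-/

noncomputable section

open Set

namespace Literature.Probability.Percolation

open LatticeModels

/-! ### The data -/

/-- **The setting of the pair step** (frame `0`, open colour): two disjoint clean open
self-avoiding arms of `{n ≤ |v| ≤ 2M}` from sites of norm `n` to `trapO M`, on the raw good event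
of the exploration of `trapDomain M` in `ω` (all terms `u < T` raw-good on some scale
`k₀ · 32^j`, `j < K`), with `1 ≤ n ≤ M`, `2 ≤ k₀`, `32 k_j + 1 ≤ M`. [cite: Nolin2008, §4.4 Lemma 15 (proof) (arXiv 0711.4948: Lemma 14)] -/
structure PairData (M n k₀ K T : ℕ) (ω : SiteConfig (Site 2)) where
  /-- the starts -/
  a : Fin 2 → Site 2
  /-- the ends, on `trapO M` -/
  y : Fin 2 → Site 2
  /-- the arms -/
  A : (i : Fin 2) → triGraph.Walk (a i) (y i)
  isPath : ∀ i, (A i).IsPath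
  supp : ∀ i, ∀ v ∈ (A i).support, v ∈ triAnnSet n (2 * M) ∩ ω
  norm_a : ∀ i, triNorm (a i) = n
  y_mem : ∀ i, y i ∈ trapO M
  clean : ∀ i, ∀ v ∈ (A i).support, triNorm v = 2 * M → v = y i
  disj : ∀ v ∈ (A 0).support, v ∉ (A 1).support
  stop : (trapDomain M).lowestSeq ω T = none
  good : ∀ u < T, ¬ TrapSeqFailRaw M u k₀ K ω
  hn : 1 ≤ n
  hnM : n ≤ M
  hk₀ : 2 ≤ k₀
  hKM : ∀ j < K, 32 * trapScale k₀ j + 1 ≤ M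

namespace PairData

variable {M n k₀ K T : ℕ} {ω : SiteConfig (Site 2)}

/-! ### The arms -/

/-- The sites of the two arms. [folklore] -/
def armSet (D : PairData M n k₀ K T ω) : Set (Site 2) := {v | ∃ i, v ∈ (D.A i).support}

/-- The stopping set of the fence of a term: the term and the arms. [folklore] -/
def S (D : PairData M n k₀ K T ω) (c : Finset (Site 2)) : Set (Site 2) := (↑c : Set (Site 2)) ∪ D.armSet

/-- Bookkeeping (`mem_armSet`). [folklore] -/
theorem mem_armSet (D : PairData M n k₀ K T ω) {v : Site 2} {i : Fin 2} (hv : v ∈ (D.A i).support) : v ∈ D.armSet := ⟨i, hv⟩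

/-- Bookkeeping (`norm_le`). [folklore] -/
theorem norm_le (D : PairData M n k₀ K T ω) {i : Fin 2} {v : Site 2} (hv : v ∈ (D.A i).support) : triNorm v ≤ 2 * M := by
  have := (mem_triAnnSet.1 (D.supp i v hv).1).2; push_cast at this; exact this

/-- Bookkeeping (`norm_ge`). [folklore] -/
theorem norm_ge (D : PairData M n k₀ K T ω) {i : Fin 2} {v : Site 2} (hv : v ∈ (D.A i).support) : (n : ℤ) ≤ triNorm v :=
  (mem_triAnnSet.1 (D.supp i v hv).1).1

/-- Bookkeeping (`mem_omega`). [folklore] -/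
theorem mem_omega (D : PairData M n k₀ K T ω) {i : Fin 2} {v : Site 2} (hv : v ∈ (D.A i).support) : v ∈ ω := (D.supp i v hv).2

/-- Bookkeeping (`armSet_norm_le`). [folklore] -/
theorem armSet_norm_le (D : PairData M n k₀ K T ω) {v : Site 2} (hv : v ∈ D.armSet) : triNorm v ≤ 2 * M := by
  obtain ⟨i, hv⟩ := hv; exact D.norm_le hv

/-- Bookkeeping (`armSet_subset`). [folklore] -/
theorem armSet_subset (D : PairData M n k₀ K T ω) : D.armSet ⊆ ω := fun _ ⟨_, hv⟩ => D.mem_omega hv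

/-- Bookkeeping (`hM`). [folklore] -/
theorem hM (D : PairData M n k₀ K T ω) : 1 ≤ M := le_trans D.hn D.hnM

/-- The start of an arm has `v₀ ≤ M` (indeed `|a₀| ≤ |a| = n ≤ M`). [folklore] -/
theorem a0_le (D : PairData M n k₀ K T ω) (i : Fin 2) : (D.a i) 0 ≤ M := by
  have h1 : (D.a i) 0 ≤ triNorm (D.a i) := by rw [triNorm_eq_max]; exact (le_max_left _ _).trans (le_max_left _ _)
  have h2 := D.norm_a i
  have h3 : (n : ℤ) ≤ M := by exact_mod_cast D.hnM
  omega

/-- The two arms are disjoint, symmetric form. [folklore] -/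
theorem disj' (D : PairData M n k₀ K T ω) {i j : Fin 2} (hij : i ≠ j) {v : Site 2} (hv : v ∈ (D.A i).support) : v ∉ (D.A j).support := by
  fin_cases i <;> fin_cases j
  · exact absurd rfl hij
  · exact D.disj v hv
  · exact fun h => D.disj v h hv
  · exact absurd rfl hij

/-! ### The terms -/

/-- Bookkeeping (`hdual`). [folklore] -/
theorem hdual (D : PairData M n k₀ K T ω) : (trapDomain M).DualProp := trapDomain_dualProp D.hM

/-- A term exists only below the stopping index. [folklore] -/
theorem lt_of_some (D : PairData M n k₀ K T ω) {u : ℕ} {c : Finset (Site 2)} {z : Site 2} (hu : (trapDomain M).lowestSeq ω u = some (c, z)) : u < T := by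
  by_contra h
  rw [JDomain.lowestSeq_eq_none_of_le D.stop (not_lt.1 h)] at hu
  exact absurd hu (by simp)

/-- Bookkeeping (`term_isCrossing`). [folklore] -/
theorem term_isCrossing {u : ℕ} {c : Finset (Site 2)} {z : Site 2} (hu : (trapDomain M).lowestSeq ω u = some (c, z)) :
    (trapDomain M).IsCrossing c z := (JDomain.isCrossing_of_lowestSeq hu).1

/-- Bookkeeping (`term_open`). [folklore] -/
theorem term_open {u : ℕ} {c : Finset (Site 2)} {z : Site 2} (hu : (trapDomain M).lowestSeq ω u = some (c, z)) :
    (↑c : Set (Site 2)) ⊆ ω := (JDomain.isCrossing_of_lowestSeq hu).2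

/-- Bookkeeping (`term_norm_le`). [folklore] -/
theorem term_norm_le {u : ℕ} {c : Finset (Site 2)} {z : Site 2} (hu : (trapDomain M).lowestSeq ω u = some (c, z))
    {v : Site 2} (hv : v ∈ c) : triNorm v ≤ 2 * M :=
  (mem_trapD_iff_triNorm.1 ((term_isCrossing hu).subset hv)).2

/-- Bookkeeping (`tip_mem`). [folklore] -/
theorem tip_mem {u : ℕ} {c : Finset (Site 2)} {z : Site 2} (hu : (trapDomain M).lowestSeq ω u = some (c, z)) :
    z ∈ trapO M := tip_mem_trapO (term_isCrossing hu)

/-- A later term lies above an earlier one. [cite: KestenPTM1982, §2.3 Prop. 2.3] -/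
theorem term_above_of_lt {u v : ℕ} (huv : u < v) {c c' : Finset (Site 2)} {z z' : Site 2}
    (hu : (trapDomain M).lowestSeq ω u = some (c, z)) (hv : (trapDomain M).lowestSeq ω v = some (c', z')) :
    c' ⊆ (trapDomain M).above c z := JDomain.lowestSeq_subset_above_of_lt (trapDomain_cutProp M) huv hu hv

/-- A later term lies off `lower` of an earlier one. [cite: KestenPTM1982, §2.3 Prop. 2.3] -/
theorem term_offLower_of_lt {u v : ℕ} (huv : u < v) {c c' : Finset (Site 2)} {z z' : Site 2}
    (hu : (trapDomain M).lowestSeq ω u = some (c, z)) (hv : (trapDomain M).lowestSeq ω v = some (c', z')) :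
    ∀ x ∈ c', x ∉ (trapDomain M).lower c z := fun _ hx hxl =>
  (JDomain.mem_lower_iff_not_mem_above ((term_isCrossing hv).subset hx)).1 hxl (term_above_of_lt huv hu hv hx)

/-- Distinct terms are disjoint. [cite: KestenPTM1982, §2.3 Prop. 2.3] -/
theorem term_disjoint_of_lt {u v : ℕ} (huv : u < v) {c c' : Finset (Site 2)} {z z' : Site 2}
    (hu : (trapDomain M).lowestSeq ω u = some (c, z)) (hv : (trapDomain M).lowestSeq ω v = some (c', z')) :
    Disjoint c c' := JDomain.lowestSeq_disjoint_of_lt (trapDomain_cutProp M) huv hu hv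

/-- An earlier term lies below a later one. [cite: KestenPTM1982, §2.3 Prop. 2.3] -/
theorem term_below_of_lt {u v : ℕ} (huv : u < v) {c c' : Finset (Site 2)} {z z' : Site 2}
    (hu : (trapDomain M).lowestSeq ω u = some (c, z)) (hv : (trapDomain M).lowestSeq ω v = some (c', z')) :
    c ⊆ (trapDomain M).below c' z' := by
  intro x hx
  have hl : x ∈ (trapDomain M).lower c' z' :=
    JDomain.lower_subset_lower_of_le (trapDomain_cutProp M) huv.le hu hv (JDomain.mem_lower.2 (Or.inl hx))
  rcases JDomain.mem_lower.1 hl with h | h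
  · exact absurd h (Finset.disjoint_left.1 (term_disjoint_of_lt huv hu hv) hx)
  · exact h

/-- The tips increase. [cite: KestenPTM1982, §2.3 Prop. 2.3] -/
theorem tip_lt_of_lt {u v : ℕ} (huv : u < v) {c c' : Finset (Site 2)} {z z' : Site 2}
    (hu : (trapDomain M).lowestSeq ω u = some (c, z)) (hv : (trapDomain M).lowestSeq ω v = some (c', z')) :
    z 1 < z' 1 := by
  have := JDomain.ht_lowestSeq_lt_of_lt (trapDomain_cutProp M) huv hu hv
  simpa using this

/-- Terms with the same index coincide (functional form). [folklore] -/
theorem term_eq {u : ℕ} {c c' : Finset (Site 2)} {z z' : Site 2}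
    (hu : (trapDomain M).lowestSeq ω u = some (c, z)) (hu' : (trapDomain M).lowestSeq ω u = some (c', z')) :
    c = c' ∧ z = z' := by
  rw [hu] at hu'
  simp only [Option.some.injEq, Prod.mk.injEq] at hu'
  exact hu'

/-! ### The scale and the fence of a term -/

/-- The index of a raw-good scale of the term. [folklore] -/
def jOf (D : PairData M n k₀ K T ω) {u : ℕ} {c : Finset (Site 2)} {z : Site 2} (hu : (trapDomain M).lowestSeq ω u = some (c, z)) : ℕ :=
  Classical.choose (exists_trapRawOK_of_not_failRaw (D.good u (D.lt_of_some hu)) hu)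

/-- Bookkeeping (`jOf_spec`). [folklore] -/
theorem jOf_spec (D : PairData M n k₀ K T ω) {u : ℕ} {c : Finset (Site 2)} {z : Site 2} (hu : (trapDomain M).lowestSeq ω u = some (c, z)) :
    D.jOf hu < K ∧ TrapRawOK M c z (trapScale k₀ (D.jOf hu)) ω :=
  Classical.choose_spec (exists_trapRawOK_of_not_failRaw (D.good u (D.lt_of_some hu)) hu)

/-- The raw-good scale of the term. [folklore] -/
def kOf (D : PairData M n k₀ K T ω) {u : ℕ} {c : Finset (Site 2)} {z : Site 2} (hu : (trapDomain M).lowestSeq ω u = some (c, z)) : ℕ :=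
  trapScale k₀ (D.jOf hu)

/-- Bookkeeping (`raw`). [folklore] -/
theorem raw (D : PairData M n k₀ K T ω) {u : ℕ} {c : Finset (Site 2)} {z : Site 2} (hu : (trapDomain M).lowestSeq ω u = some (c, z)) :
    TrapRawOK M c z (D.kOf hu) ω := (D.jOf_spec hu).2

/-- Bookkeeping (`one_le_kOf`). [folklore] -/
theorem one_le_kOf (D : PairData M n k₀ K T ω) {u : ℕ} {c : Finset (Site 2)} {z : Site 2} (hu : (trapDomain M).lowestSeq ω u = some (c, z)) :
    1 ≤ D.kOf hu := one_le_trapScale (by have := D.hk₀; omega) _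

/-- Bookkeeping (`two_le_kOf`). [folklore] -/
theorem two_le_kOf (D : PairData M n k₀ K T ω) {u : ℕ} {c : Finset (Site 2)} {z : Site 2} (hu : (trapDomain M).lowestSeq ω u = some (c, z)) :
    2 ≤ D.kOf hu := Nat.mul_le_mul D.hk₀ (Nat.one_le_pow _ _ (by norm_num))

/-- Bookkeeping (`kOf_le`). [folklore] -/
theorem kOf_le (D : PairData M n k₀ K T ω) {u : ℕ} {c : Finset (Site 2)} {z : Site 2} (hu : (trapDomain M).lowestSeq ω u = some (c, z)) :
    32 * D.kOf hu + 1 ≤ M := D.hKM _ (D.jOf_spec hu).1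

/-- Bookkeeping (`c_subset_S`). [folklore] -/
theorem c_subset_S (D : PairData M n k₀ K T ω) (c : Finset (Site 2)) : (↑c : Set (Site 2)) ⊆ D.S c := Set.subset_union_left

/-- Bookkeeping (`S_norm_le`). [folklore] -/
theorem S_norm_le (D : PairData M n k₀ K T ω) {u : ℕ} {c : Finset (Site 2)} {z : Site 2} (hu : (trapDomain M).lowestSeq ω u = some (c, z)) :
    ∀ v ∈ D.S c, triNorm v ≤ 2 * M := by
  rintro v (hv | hv)
  · exact term_norm_le hu (Finset.mem_coe.1 hv)
  · exact D.armSet_norm_le hv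

/-- **The fence of the term, stopped at `c ∪ (arms)`.** [cite: Nolin2008, §4.4 Lemma 15 (proof) (arXiv 0711.4948: Lemma 14)] -/
def fence (D : PairData M n k₀ K T ω) {u : ℕ} {c : Finset (Site 2)} {z : Site 2} (hu : (trapDomain M).lowestSeq ω u = some (c, z)) :
    TermFence M c z (D.kOf hu) ω (D.S c) :=
  Classical.choice ((D.raw hu).nonempty_termFence (D.one_le_kOf hu)
    (by have := D.kOf_le hu; omega) (term_isCrossing hu) (D.c_subset_S c) (D.S_norm_le hu))

/-! ### The admissible set and the targets -/

/-- **The admissible sites**: the arms, the terms, the connections of their fences. [cite: Nolin2008, §4.4 Lemma 15 (proof) (arXiv 0711.4948: Lemma 14)] -/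
def Aset (D : PairData M n k₀ K T ω) : Set (Site 2) :=
  D.armSet ∪ {v | ∃ (u : ℕ) (c : Finset (Site 2)) (z : Site 2) (hu : (trapDomain M).lowestSeq ω u = some (c, z)),
    v ∈ (↑c : Set (Site 2)) ∨ v ∈ (D.fence hu).F}

/-- **The targets**: the exterior fence sites of the terms. [cite: Nolin2008, §4.4 Lemma 15 (proof) (arXiv 0711.4948: Lemma 14)] -/
def Tset (D : PairData M n k₀ K T ω) : Set (Site 2) :=
  {v | ∃ (u : ℕ) (c : Finset (Site 2)) (z : Site 2) (hu : (trapDomain M).lowestSeq ω u = some (c, z)), v = (D.fence hu).m}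

/-- Bookkeeping (`armSet_subset_Aset`). [folklore] -/
theorem armSet_subset_Aset (D : PairData M n k₀ K T ω) : D.armSet ⊆ D.Aset := Set.subset_union_left

/-- Bookkeeping (`term_subset_Aset`). [folklore] -/
theorem term_subset_Aset (D : PairData M n k₀ K T ω) {u : ℕ} {c : Finset (Site 2)} {z : Site 2} (hu : (trapDomain M).lowestSeq ω u = some (c, z)) :
    (↑c : Set (Site 2)) ⊆ D.Aset := fun _ hv => Or.inr ⟨u, c, z, hu, Or.inl hv⟩

/-- Bookkeeping (`fence_subset_Aset`). [folklore] -/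
theorem fence_subset_Aset (D : PairData M n k₀ K T ω) {u : ℕ} {c : Finset (Site 2)} {z : Site 2} (hu : (trapDomain M).lowestSeq ω u = some (c, z)) :
    (D.fence hu).F ⊆ D.Aset := fun _ hv => Or.inr ⟨u, c, z, hu, Or.inr hv⟩

/-- Bookkeeping (`m_mem_Tset`). [folklore] -/
theorem m_mem_Tset (D : PairData M n k₀ K T ω) {u : ℕ} {c : Finset (Site 2)} {z : Site 2} (hu : (trapDomain M).lowestSeq ω u = some (c, z)) :
    (D.fence hu).m ∈ D.Tset := ⟨u, c, z, hu, rfl⟩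

/-- The admissible sites are open. [folklore] -/
theorem Aset_subset (D : PairData M n k₀ K T ω) : D.Aset ⊆ ω := by
  rintro v (hv | ⟨u, c, z, hu, hv | hv⟩)
  · exact D.armSet_subset hv
  · exact term_open hu hv
  · exact fenceSet_subset ((D.fence hu).F_subset hv)

/-! ### The planar position of the fences -/

/-- The connection of a fence avoids the arms. [folklore] -/
theorem fence_disjoint_arm (D : PairData M n k₀ K T ω) {u : ℕ} {c : Finset (Site 2)} {z : Site 2} (hu : (trapDomain M).lowestSeq ω u = some (c, z))
    {v : Site 2} (hv : v ∈ (D.fence hu).F) : v ∉ D.armSet := fun h =>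
  fenceSet_disjoint ((D.fence hu).F_subset hv) (Or.inr h)

/-- The connection of a fence avoids every term. [cite: Nolin2008, §4.4 Lemma 15 (proof) (arXiv 0711.4948: Lemma 14)] -/
theorem fence_disjoint_term (D : PairData M n k₀ K T ω) {u v : ℕ} {c c' : Finset (Site 2)} {z z' : Site 2}
    (hu : (trapDomain M).lowestSeq ω u = some (c, z)) (hv : (trapDomain M).lowestSeq ω v = some (c', z'))
    {x : Site 2} (hx : x ∈ (D.fence hu).F) : x ∉ c' := by
  rcases lt_trichotomy v u with h | rfl | h
  · exact (D.fence hu).not_mem_of_subset_below (term_below_of_lt h hv hu) hx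
  · have := (term_eq hu hv).1; subst this
    exact fun h => fenceSet_disjoint ((D.fence hu).F_subset hx) (Or.inl (Finset.mem_coe.2 h))
  · exact (D.fence hu).not_mem_of_offLower (D.raw hu) (D.one_le_kOf hu) (by have := D.kOf_le hu; omega)
      (term_isCrossing hu) (term_isCrossing hv) (term_open hv) (term_offLower_of_lt h hu hv) hx

/-- **Tips of distinct terms are far apart** in the scale of the lower one: `z 1 + 17 k_u < z' 1`
for `u < v`. [cite: Nolin2008, §4.4 Lemma 15 (proof) (arXiv 0711.4948: Lemma 14)] -/
theorem row_gap_of_lt (D : PairData M n k₀ K T ω) {u v : ℕ} (huv : u < v) {c c' : Finset (Site 2)} {z z' : Site 2}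
    (hu : (trapDomain M).lowestSeq ω u = some (c, z)) (hv : (trapDomain M).lowestSeq ω v = some (c', z')) :
    z 1 + 17 * D.kOf hu < z' 1 :=
  (D.raw hu).row_gap (D.one_le_kOf hu) (by have := D.kOf_le hu; omega) (term_isCrossing hu)
    (term_isCrossing hv) (term_open hv) (term_offLower_of_lt huv hu hv) (tip_lt_of_lt huv hu hv)

/-- **Connections of distinct fences are disjoint.** [cite: Nolin2008, §4.4 Lemma 15 (proof) (arXiv 0711.4948: Lemma 14)] -/
theorem fence_disjoint_fence (D : PairData M n k₀ K T ω) {u v : ℕ} (huv : u ≠ v) {c c' : Finset (Site 2)} {z z' : Site 2}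
    (hu : (trapDomain M).lowestSeq ω u = some (c, z)) (hv : (trapDomain M).lowestSeq ω v = some (c', z'))
    {x : Site 2} (hx : x ∈ (D.fence hu).F) : x ∉ (D.fence hv).F := by
  intro hx'
  wlog h : u < v generalizing u v c c' z z'
  · exact this huv.symm hv hu hx' hx (lt_of_le_of_ne (not_lt.1 h) huv.symm)
  have hgap := D.row_gap_of_lt h hu hv
  have hk := D.one_le_kOf hu
  by_cases hn : triNorm x ≤ 2 * M
  · have hxa := (mem_fenceSet_inside ((D.fence hv).F_subset hx') hn).2.1
    exact (D.fence hu).not_mem_above_of_row_lt hk (tip_mem hu) (term_isCrossing hv) (by omega)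
      (fun w hw => D.fence_disjoint_term hu hv hw) hx hn hxa
  · rw [not_le] at hn
    have h1 := mem_fenceSet_outside ((D.fence hv).F_subset hx') hn
    have h2 := (fenceSet_box ((D.fence hu).F_subset hx)).2.2.2
    omega

/-- **A site lies in the structure `c_u ∪ F_u` of at most one term.** [folklore] -/
theorem term_eq_of_mem_struct (D : PairData M n k₀ K T ω) {u v : ℕ} {c c' : Finset (Site 2)} {z z' : Site 2}
    (hu : (trapDomain M).lowestSeq ω u = some (c, z)) (hv : (trapDomain M).lowestSeq ω v = some (c', z'))
    {x : Site 2} (hxu : x ∈ (↑c : Set (Site 2)) ∨ x ∈ (D.fence hu).F) (hxv : x ∈ (↑c' : Set (Site 2)) ∨ x ∈ (D.fence hv).F) :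
    u = v := by
  by_contra hne
  rcases hxu with hxu | hxu <;> rcases hxv with hxv | hxv
  · rcases lt_or_gt_of_ne hne with h | h
    · exact Finset.disjoint_left.1 (term_disjoint_of_lt h hu hv) (Finset.mem_coe.1 hxu) (Finset.mem_coe.1 hxv)
    · exact Finset.disjoint_left.1 (term_disjoint_of_lt h hv hu) (Finset.mem_coe.1 hxv) (Finset.mem_coe.1 hxu)
  · exact D.fence_disjoint_term hv hu hxv (Finset.mem_coe.1 hxu)
  · exact D.fence_disjoint_term hu hv hxu (Finset.mem_coe.1 hxv)
  · exact D.fence_disjoint_fence hne hu hv hxu hxv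

/-- The fence site of a term is outside `Λ_{2M}`, in particular not an admissible site of `Λ_{2M}`. [folklore] -/
theorem norm_m (D : PairData M n k₀ K T ω) {u : ℕ} {c : Finset (Site 2)} {z : Site 2} (hu : (trapDomain M).lowestSeq ω u = some (c, z)) :
    2 * (M : ℤ) < triNorm (D.fence hu).m := (D.fence hu).norm_m (D.one_le_kOf hu) (tip_mem hu)

/-- Distinct terms have distinct fence sites. [folklore] -/
theorem m_ne_of_ne (D : PairData M n k₀ K T ω) {u v : ℕ} (huv : u ≠ v) {c c' : Finset (Site 2)} {z z' : Site 2}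
    (hu : (trapDomain M).lowestSeq ω u = some (c, z)) (hv : (trapDomain M).lowestSeq ω v = some (c', z')) :
    (D.fence hu).m ≠ (D.fence hv).m := fun h =>
  D.fence_disjoint_fence huv hu hv (D.fence hu).m_mem (h ▸ (D.fence hv).m_mem)

end PairData

end Literature.Probability.Percolation
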